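import Summits.BirchSwinnertonDyer.BirchSwinnertonDyer.Theorems.SignedLowerHalvesSmallImageLowerHalfBothSignsRttD2J2DeltaFibre
import Literature.NumberTheory.GaloisRepresentations.ContinuousShapiroOpenCoinduced
import Literature.NumberTheory.GaloisRepresentations.ContinuousCohomologyConnecting
import Literature.NumberTheory.GaloisRepresentations.FiniteCoefficients
import HarnessLib

/-!
# Route `SignedLowerHalves`, crux L `SmallImageLowerHalfBothSigns` (stmt-BirchSwinnertonDyer-23599), line `rtt_w3` v15 — E2, junction row J2,
# research half «δ₁», brick (δ-b1): THE FINITE-LEVEL SPECIALISATION SEQUENCE `0 → ker Σ → Maps(G ⧸ V, M) —Σ→ Maps(G ⧸ U, M) → 0` AS AN `IsSES`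
# (kernel model) AND ITS MORPHISMS (level change, coefficient change, right translation)

INPUTS hand `bsd-inputs-honda-p1` g24 under LEAD `cruxlead-stmt-BirchSwinnertonDyer-23599` g11 (v15 SPEC, stub B `stub_charRoadJunction_ns`, row J2; J2 socket p786107).
Generic continuous-representation theory (no number theory): `G` a compact topological group, `ρ : ContinuousRep G ℤ M` a discrete module, subgroups `V ≤ U` of
`G` (`V` open, `G ⧸ V` finite).
* §1 `sumKer ρ h` — the kernel of the fibre sum `Σ : Maps(G ⧸ V, M) → Maps(G ⧸ U, M)` (a `G`-stable subgroup), the sub-representation `kerRep`, its inclusion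
  `kerIncl`, and ★ `isSES_kerIncl_coindFinSum` — `0 → ker Σ → Maps(G ⧸ V, M) —Σ→ Maps(G ⧸ U, M) → 0` is a short exact sequence of discrete `G`-modules (the
  tree's `IsSES`; its `δ₁ : H¹(G, Maps(G ⧸ U, M)) → H²(G, ker Σ)` is the finite-level specialisation connecting map under Shapiro — brick (δ-b2));
* §2 the maps BETWEEN these sequences: `kerMapSum` (induced by a deeper fibre sum `Σ_{V'→V}`), `kerMapCoeff` (by a coefficient morphism), `kerMapRTrans` (by a
  right translation `R_γ`), with their values (the squares `hsq₁`/`hsq₂` of the tree's `IsSES.cohomologyMap_δ₁` hold by `rfl`/brick (δ-a)).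
DEFINITIONS WITH BODIES + THEOREMS (`--supports stmt-BirchSwinnertonDyer-23599` helper); no named fact, no `sorry`, no instance; crux L, crux M, E2 and BSD remain OPEN
and are proved for NO curve by any of this.
References: [SerreLocalFields1979] VII §5–§6; [NeukirchSchmidtWingberg2008] I §3 (1.3.2)–(1.3.3), I §5–§6; [SerreGaloisCohomology1997] I §2.2–§2.5.
-/

set_option autoImplicit false
-- the Theorems namespace of this sub repeats the summit name by design (D-0017 nested layout)
set_option linter.dupNamespace false

noncomputable section

open CategoryTheory
open scoped Classical

universe u

namespace Summit.BirchSwinnertonDyer.BirchSwinnertonDyer.Theorems.SmallImageRttD2J2Delta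

open Literature.NumberTheory.GaloisRepresentations

variable {G : Type u} [Group G] [TopologicalSpace G] [IsTopologicalGroup G] [CompactSpace G]
variable {M : Type u} [AddCommGroup M] [TopologicalSpace M] [DiscreteTopology M] (ρ : ContinuousRep G ℤ M)

/-! ## §1 The kernel of the fibre sum and the short exact sequence -/

section Ker

variable {U V : Subgroup G} (h : V ≤ U)

/-- **`ker Σ ≤ Maps(G ⧸ V, M)`**, the kernel of the fibre sum `Σ : Maps(G ⧸ V, M) → Maps(G ⧸ U, M)` along `G ⧸ V → G ⧸ U`.
[cite: NeukirchSchmidtWingberg2008, I §5 Prop. (1.5.3)] -/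
def sumKer [Fintype (G ⧸ V)] : Submodule ℤ (G ⧸ V → M) :=
  LinearMap.ker (coindFinSum ρ.toTopRep h).hom.toLinearMap

omit [IsTopologicalGroup G] [CompactSpace G] in
/-- Membership in `sumKer`. [cite: NeukirchSchmidtWingberg2008, I §5 Prop. (1.5.3)] -/
theorem mem_sumKer [Fintype (G ⧸ V)] {ψ : G ⧸ V → M} : ψ ∈ sumKer ρ h ↔ (coindFinSum ρ.toTopRep h).hom ψ = 0 := Iff.rfl

/-- `ker Σ` is `G`-stable (`Σ` is equivariant). [cite: NeukirchSchmidtWingberg2008, I §5 Prop. (1.5.3)] -/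
theorem sumKer_le_comap [Fintype (G ⧸ V)] (hV : IsOpen (V : Set G)) (g : G) : sumKer ρ h ≤ (sumKer ρ h).comap (ρ.coindOpen V hV g) :=
  fun ψ hψ => (mem_sumKer ρ h).2 (by
    change (coindFinSum ρ.toTopRep h).hom ((coindFin.{0, u} ρ.toTopRep V).ρ g ψ) = 0
    rw [TopRep.hom_comm_apply, (mem_sumKer ρ h).1 hψ, map_zero])

variable (hV : IsOpen (V : Set G)) [Fintype (G ⧸ V)]

/-- **`ker Σ` as a discrete `G`-module** (sub-representation of `Maps(G ⧸ V, M)`). [cite: SerreGaloisCohomology1997, I §2.2] -/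
def kerRep : ContinuousRep G ℤ (sumKer ρ h) :=
  (ρ.coindOpen V hV).subrepresentation (sumKer ρ h) (sumKer_le_comap ρ h hV)

/-- The inclusion `ker Σ ↪ Maps(G ⧸ V, M)` as a morphism of topological representations. [cite: SerreGaloisCohomology1997, I §2.2] -/
def kerIncl : (kerRep ρ h hV).toTopRep ⟶ coindFin.{0, u} ρ.toTopRep V :=
  subtypeHom (ρ.coindOpen V hV) (sumKer ρ h) (sumKer_le_comap ρ h hV)

/-- `kerIncl` on elements. [cite: SerreGaloisCohomology1997, I §2.2] -/
@[simp] theorem kerIncl_apply (ψ : sumKer ρ h) : (kerIncl ρ h hV).hom ψ = (ψ : G ⧸ V → M) := rfl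

/-- The action of `kerRep` on elements is that of `Maps(G ⧸ V, M)`. [cite: SerreGaloisCohomology1997, I §2.2] -/
theorem kerRep_apply_coe (g : G) (ψ : sumKer ρ h) :
    ((kerRep ρ h hV) g ψ : G ⧸ V → M) = (coindFin.{0, u} ρ.toTopRep V).ρ g (ψ : G ⧸ V → M) := rfl

/-- ★ **`0 → ker Σ → Maps(G ⧸ V, M) —Σ→ Maps(G ⧸ U, M) → 0` is a short exact sequence of discrete `G`-modules** (the fibre sum is onto, brick (δ-a)).
Under Shapiro (`Hⁿ(G, Maps(G ⧸ N, M)) = Hⁿ(N, M)`, `Hⁿ(Σ) = cor`) its long exact sequence is the finite-level specialisation sequence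
`H¹(V, M) —cor→ H¹(U, M) —δ→ H²(G, ker Σ) → H²(V, M) —cor→ H²(U, M)`. [cite: SerreGaloisCohomology1997, I §2.2–§2.5] [cite: NeukirchSchmidtWingberg2008, (1.3.2), I §6 Prop. (1.6.4)] -/
theorem isSES_kerIncl_coindFinSum (hU : IsOpen (U : Set G)) [Fintype (G ⧸ U)] :
    IsSES (ρ₁ := kerRep ρ h hV) (ρ₂ := ρ.coindOpen V hV) (ρ₃ := ρ.coindOpen U hU) (kerIncl ρ h hV) (coindFinSum ρ.toTopRep h) where
  comp_eq_zero := by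
    ext ψ y
    exact congrFun ((mem_sumKer ρ h).1 ψ.2) y
  injective := Subtype.val_injective
  exact_mid := fun ψ hψ => ⟨⟨ψ, (mem_sumKer ρ h).2 hψ⟩, rfl⟩
  surjective := coindFinSum_surjective ρ.toTopRep h

end Ker

/-! ## §2 Morphisms between the kernel sequences -/

section Maps

variable {U V U' V' : Subgroup G}

omit [TopologicalSpace G] [IsTopologicalGroup G] [CompactSpace G] in
/-- Surjectivity of `G ⧸ V' → G ⧸ U'`, as a finiteness transfer. [folklore] -/
theorem finite_quotient_of_le (h' : V' ≤ U') [Fintype (G ⧸ V')] : Finite (G ⧸ U') :=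
  Finite.of_surjective (Subgroup.quotientMapOfLE h' : G ⧸ V' → G ⧸ U') fun y => by
    induction y using QuotientGroup.induction_on with
    | H a => exact ⟨(a : G ⧸ V'), rfl⟩

omit [IsTopologicalGroup G] [CompactSpace G] in
/-- A deeper fibre sum carries `ker Σ'` into `ker Σ` (transitivity of fibre sums). [cite: NeukirchSchmidtWingberg2008, I §5 Prop. (1.5.3)] -/
theorem coindFinSum_mem_sumKer (h : V ≤ U) (h' : V' ≤ U') (hVV : V' ≤ V) (hUU : U' ≤ U) [Fintype (G ⧸ V)] [Fintype (G ⧸ V')]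
    (ψ : sumKer ρ h') : (coindFinSum ρ.toTopRep hVV).hom (ψ : G ⧸ V' → M) ∈ sumKer ρ h := by
  haveI : Finite (G ⧸ U') := finite_quotient_of_le h'
  letI : Fintype (G ⧸ U') := Fintype.ofFinite _
  refine (mem_sumKer ρ h).2 ?_
  have hcomm : (coindFinSum ρ.toTopRep h).hom ((coindFinSum ρ.toTopRep hVV).hom (ψ : G ⧸ V' → M)) =
      (coindFinSum ρ.toTopRep hUU).hom ((coindFinSum ρ.toTopRep h').hom (ψ : G ⧸ V' → M)) := by
    rw [coindFinSum_coindFinSum, coindFinSum_coindFinSum]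
  rw [hcomm, (mem_sumKer ρ h').1 ψ.2, map_zero]

/-- **The map `ker Σ' → ker Σ` induced by the fibre sum `Σ_{V'→V}`** (first component of the level-change morphism of kernel sequences).
[cite: NeukirchSchmidtWingberg2008, (1.3.3)] -/
def kerMapSum (h : V ≤ U) (h' : V' ≤ U') (hVV : V' ≤ V) (hUU : U' ≤ U) (hV : IsOpen (V : Set G)) (hV' : IsOpen (V' : Set G))
    [Fintype (G ⧸ V)] [Fintype (G ⧸ V')] : (kerRep ρ h' hV').toTopRep ⟶ (kerRep ρ h hV).toTopRep :=
  TopRep.ofHom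
    { toLinearMap := LinearMap.codRestrict (sumKer ρ h) ((coindFinSum ρ.toTopRep hVV).hom.toLinearMap.comp (sumKer ρ h').subtype)
        (coindFinSum_mem_sumKer ρ h h' hVV hUU)
      cont := continuous_of_discreteTopology
      isIntertwining' := fun g => by
        refine ContinuousLinearMap.ext fun ψ => Subtype.ext ?_
        change (coindFinSum ρ.toTopRep hVV).hom ((coindFin.{0, u} ρ.toTopRep V').ρ g (ψ : G ⧸ V' → M)) =
          (coindFin.{0, u} ρ.toTopRep V).ρ g ((coindFinSum ρ.toTopRep hVV).hom (ψ : G ⧸ V' → M))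
        exact TopRep.hom_comm_apply _ g _ }

/-- `kerMapSum` on elements. [cite: NeukirchSchmidtWingberg2008, (1.3.3)] -/
@[simp] theorem kerMapSum_apply_coe (h : V ≤ U) (h' : V' ≤ U') (hVV : V' ≤ V) (hUU : U' ≤ U) (hV : IsOpen (V : Set G))
    (hV' : IsOpen (V' : Set G)) [Fintype (G ⧸ V)] [Fintype (G ⧸ V')] (ψ : sumKer ρ h') :
    ((kerMapSum ρ h h' hVV hUU hV hV').hom ψ : G ⧸ V → M) = (coindFinSum ρ.toTopRep hVV).hom (ψ : G ⧸ V' → M) := rfl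

end Maps

section MapsCoeff

variable {M' : Type u} [AddCommGroup M'] [TopologicalSpace M'] [DiscreteTopology M'] (ρ' : ContinuousRep G ℤ M') (f : ρ.toTopRep ⟶ ρ'.toTopRep)
  {U V : Subgroup G} (h : V ≤ U)

omit [IsTopologicalGroup G] [CompactSpace G] in
/-- A coefficient morphism carries `ker Σ` into `ker Σ`. [cite: SerreLocalFields1979, VII §6] -/
theorem coindFinMap_mem_sumKer [Fintype (G ⧸ V)] (ψ : sumKer ρ h) : (coindFinMap f V).hom (ψ : G ⧸ V → M) ∈ sumKer ρ' h :=
  (mem_sumKer ρ' h).2 (by rw [← coindFinMap_coindFinSum, (mem_sumKer ρ h).1 ψ.2, map_zero])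

variable (hV : IsOpen (V : Set G)) [Fintype (G ⧸ V)]

/-- **The map `ker Σ(M) → ker Σ(M')` induced by a coefficient morphism `f : M → M'`.** [cite: SerreLocalFields1979, VII §6] -/
def kerMapCoeff : (kerRep ρ h hV).toTopRep ⟶ (kerRep ρ' h hV).toTopRep :=
  TopRep.ofHom
    { toLinearMap := LinearMap.codRestrict (sumKer ρ' h) ((coindFinMap f V).hom.toLinearMap.comp (sumKer ρ h).subtype)
        (coindFinMap_mem_sumKer ρ ρ' f h)
      cont := continuous_of_discreteTopology
      isIntertwining' := fun g => by
        refine ContinuousLinearMap.ext fun ψ => Subtype.ext ?_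
        change (coindFinMap f V).hom ((coindFin.{0, u} ρ.toTopRep V).ρ g (ψ : G ⧸ V → M)) =
          (coindFin.{0, u} ρ'.toTopRep V).ρ g ((coindFinMap f V).hom (ψ : G ⧸ V → M))
        exact TopRep.hom_comm_apply _ g _ }

/-- `kerMapCoeff` on elements. [cite: SerreLocalFields1979, VII §6] -/
@[simp] theorem kerMapCoeff_apply_coe (ψ : sumKer ρ h) :
    ((kerMapCoeff ρ ρ' f h hV).hom ψ : G ⧸ V → M') = (coindFinMap f V).hom (ψ : G ⧸ V → M) := rfl

end MapsCoeff

section MapsRTrans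

variable {U V : Subgroup G} (h : V ≤ U) [U.Normal] [V.Normal]

omit [IsTopologicalGroup G] [CompactSpace G] in
/-- Right translations carry `ker Σ` into `ker Σ`. [cite: SerreLocalFields1979, VII §5] -/
theorem rTransHom_mem_sumKer [Fintype (G ⧸ V)] (γ : G) (ψ : sumKer ρ h) :
    (rTransHom ρ.toTopRep V (γ : G ⧸ V)).hom (ψ : G ⧸ V → M) ∈ sumKer ρ h :=
  (mem_sumKer ρ h).2 (by rw [coindFinSum_rTransHom, (mem_sumKer ρ h).1 ψ.2, map_zero])

variable (hV : IsOpen (V : Set G)) [Fintype (G ⧸ V)]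

/-- **The map `ker Σ → ker Σ` induced by the right translation `R_γ`.** [cite: SerreLocalFields1979, VII §5] -/
def kerMapRTrans (γ : G) : (kerRep ρ h hV).toTopRep ⟶ (kerRep ρ h hV).toTopRep :=
  TopRep.ofHom
    { toLinearMap := LinearMap.codRestrict (sumKer ρ h) ((rTransHom ρ.toTopRep V (γ : G ⧸ V)).hom.toLinearMap.comp (sumKer ρ h).subtype)
        (rTransHom_mem_sumKer ρ h γ)
      cont := continuous_of_discreteTopology
      isIntertwining' := fun g => by
        refine ContinuousLinearMap.ext fun ψ => Subtype.ext ?_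
        change (rTransHom ρ.toTopRep V (γ : G ⧸ V)).hom ((coindFin.{0, u} ρ.toTopRep V).ρ g (ψ : G ⧸ V → M)) =
          (coindFin.{0, u} ρ.toTopRep V).ρ g ((rTransHom ρ.toTopRep V (γ : G ⧸ V)).hom (ψ : G ⧸ V → M))
        exact TopRep.hom_comm_apply _ g _ }

/-- `kerMapRTrans` on elements. [cite: SerreLocalFields1979, VII §5] -/
@[simp] theorem kerMapRTrans_apply_coe (γ : G) (ψ : sumKer ρ h) :
    ((kerMapRTrans ρ h hV γ).hom ψ : G ⧸ V → M) = (rTransHom ρ.toTopRep V (γ : G ⧸ V)).hom (ψ : G ⧸ V → M) := rfl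

end MapsRTrans

end Summit.BirchSwinnertonDyer.BirchSwinnertonDyer.Theorems.SmallImageRttD2J2Delta

end
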